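import Summits.QuantumAdvantage.QuantumAdvantage.Theorems.NearExactIsExact.Negative.AffineDigitCaseAFourteen
import Summits.QuantumAdvantage.QuantumAdvantage.Theorems.CubicForrelationSignedCubicForrelationNotPrBPPStubKernelNormalFormMaps
import Summits.QuantumAdvantage.QuantumAdvantage.Theorems.CubicForrelationSignedCubicForrelationNotPrBPPStubKernelNormalFormDegree

/-!
# Translation covariance of the case-A data at `n = 14` (frame-free tool for THEOREM CA-W; NearExactIsExact, disprover gen 23)

Negative/structural lemmas for the crux `CubicForrelation.NearExactIsExact` (item r2), finite slice `n = 14`.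
HONEST FRAMING: bookkeeping about cubic Boolean functions — NOT summit progress; no violation of `NearExactIsExact`,
no per-`n` value.

THEOREM CA-W (`CaseAWindowFourteen.caseA_window_false`) is stated in a coordinate NORMAL FORM in which the digit
`d₁ = [⌊u/2⌋ odd]` reads `pq ⊕ λ(a″)` with no linear terms in the two non-radical coordinates.  Reaching that form from
frame-free data needs, besides a linear change of coordinates (tree: `stub_linearTransport`), a TRANSLATION of the pair:
`(f, g) ↦ (f ⊕ ⟨·,s⟩, g(· ⊕ s))`.  This file proves that the translation preserves every hypothesis of CA-W and shifts the
digit by the linear functional `⟨·,s⟩`: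
* `ct_forrelation_translate` (general `n`): `Φ(f ⊕ ⟨·,s⟩, g(· ⊕ s)) = Φ(f, g)`;
* `ct_caseA_translate` (`n = 14`): for cubic `f, g` with `W_g = 32u`, `u` odd and case A (`[⌊u/2⌋ odd] ≠ [⌊u/4⌋ odd]`
  everywhere), the translated pair is cubic with `W = 32u'`, `u' = (−1)^{s·x} u` odd and again case A, the same forrelation,
  and digit `[⌊u'/2⌋ odd] = [⌊u/2⌋ odd] ⊕ [s·x odd]`.
Hence in the frame-free assembly of CA-W one may first remove the affine part of `d₁` by a translation (every case-A digit
is `p·q ⊕ μ` with `μ` affine, `CaseARankTwoFourteen` + `CaseADigitNotAffineFourteen`), then change coordinates linearly.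

Sources: [this work]; translation covariance of the Walsh–Hadamard transform [cite ODonnell2014 §1.4] (`ad_W_translate`).
Standard axioms only.
-/

set_option linter.dupNamespace false -- D-0017: single-problem summit ⇒ `QuantumAdvantage.QuantumAdvantage` by design

noncomputable section

namespace Summit.QuantumAdvantage.QuantumAdvantage.Theorems.NearExactIsExact.Negative.CaseATranslateFourteen

open Finset
open Literature.Computability.QuantumComplexity
open Literature.Computability.QuantumComplexity.BuzetChailloux (bxor bxorPerm bxorPerm_apply twist_bxor_right)
open Literature.Computability.QuantumComplexity.DerivativeWalsh (W)
open Summit.QuantumAdvantage.QuantumAdvantage.Theorems.CubicForrelation.NearExactIsExact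
open Summit.QuantumAdvantage.QuantumAdvantage.Theorems.SignedCubicForrelationNotPrBPP (knf_signOf_ip knf_isDegLeFun_ip)
open Summit.QuantumAdvantage.QuantumAdvantage.Theorems.NearExactIsExact.Negative.AffineDigitCaseAFourteen
  (ad_translate_isDegLeFun ad_W_translate)

/-- **Translation invariance of forrelation**: `Φ(f ⊕ ⟨·,s⟩, g(· ⊕ s)) = Φ(f, g)` — translating `g` by `s` multiplies
`W_g` by the character `(−1)^{s·x}`, which is absorbed by adding the parity `⟨x,s⟩` to `f`. [folklore] -/
theorem ct_forrelation_translate {n : ℕ} (f g : (Fin n → Bool) → Bool) (s : Fin n → Bool) :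
    forrelation (fun x => f x ^^ decide (Odd #(univ.filter fun i => x i && s i))) (fun y => g (bxor y s)) =
      forrelation f g := by
  unfold forrelation
  congr 1
  refine sum_congr rfl fun x _ => ?_
  have hcomm : ∀ y : Fin n → Bool, bxor y s = bxor s y := fun y => funext fun i => Bool.xor_comm _ _
  simp_rw [hcomm, signOf_xor, knf_signOf_ip]
  have hre : ∑ y, signOf (f x) * twist x y * signOf (g y) =
      ∑ y, signOf (f x) * twist x (bxor s y) * signOf (g (bxor s y)) :=
    (Equiv.sum_comp (bxorPerm s) (fun y => signOf (f x) * twist x y * signOf (g y))).symm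
  rw [hre]
  refine sum_congr rfl fun y _ => ?_
  rw [twist_bxor_right]
  ring

/-- The sign flip `u ↦ −u` of an odd integer complements both binary digits `⌊u/2⌋, ⌊u/4⌋ (mod 2)`; in particular it
preserves case A. [folklore] -/
theorem ct_neg_digits (v : ℤ) (hv : Odd v) :
    (Odd (-v / 2) ↔ ¬ Odd (v / 2)) ∧ (Odd (-v / 2 / 2) ↔ ¬ Odd (v / 2 / 2)) := by
  obtain ⟨k, rfl⟩ := hv
  simp only [Int.odd_iff]
  constructor <;> constructor <;> intro h <;> omega

/-- **Translation covariance of the case-A data (`n = 14`).** For cubic `f, g` with `W_g = 32u`, `u` odd and case A, and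
any `s`, the translated pair `(f ⊕ ⟨·,s⟩, g(· ⊕ s))` is cubic with normalised spectrum `u' = (−1)^{s·x} u` odd and case A,
has the same forrelation, and its digit is `[⌊u'/2⌋ odd] = [⌊u/2⌋ odd] ⊕ [⟨x,s⟩ odd]` (stated as `↔ (… ↔ twist s x = 1)`).
ONE-SIDED bookkeeping; NOT summit progress. [this work] -/
theorem ct_caseA_translate (f g : (Fin (7 + 7) → Bool) → Bool) (hf : IsDegLeFun 3 f) (hg : IsDegLeFun 3 g)
    (u : (Fin (7 + 7) → Bool) → ℤ) (hu : ∀ x, W (fun y => signOf (g y)) x = (2 : ℝ) ^ 5 * (u x : ℝ))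
    (hodd : ∀ x, Odd (u x)) (hA : ∀ x, ¬ (Odd (u x / 2) ↔ Odd (u x / 2 / 2))) (s : Fin (7 + 7) → Bool) :
    IsDegLeFun 3 (fun x => f x ^^ decide (Odd #(univ.filter fun i => x i && s i))) ∧
    IsDegLeFun 3 (fun y => g (bxor y s)) ∧
    (∀ x, W (fun y => signOf (g (bxor y s))) x =
      (2 : ℝ) ^ 5 * ((if twist s x = 1 then u x else -u x : ℤ) : ℝ)) ∧
    (∀ x, Odd (if twist s x = 1 then u x else -u x)) ∧
    (∀ x, ¬ (Odd ((if twist s x = 1 then u x else -u x) / 2) ↔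
      Odd ((if twist s x = 1 then u x else -u x) / 2 / 2))) ∧
    forrelation (fun x => f x ^^ decide (Odd #(univ.filter fun i => x i && s i))) (fun y => g (bxor y s)) =
      forrelation f g ∧
    (∀ x, Odd ((if twist s x = 1 then u x else -u x) / 2) ↔ (Odd (u x / 2) ↔ twist s x = 1)) := by
  refine ⟨fc_deg_bxor hf ((knf_isDegLeFun_ip s).mono (by norm_num)), ad_translate_isDegLeFun g hg s,
    fun x => ?_, fun x => ?_, fun x => ?_, ct_forrelation_translate f g s, fun x => ?_⟩
  · rw [ad_W_translate, hu x]
    rcases tc_twist_cases s x with h | h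
    · rw [h, if_pos rfl, one_mul]
    · rw [h, if_neg (by norm_num)]
      push_cast
      ring
  · split_ifs
    · exact hodd x
    · exact (hodd x).neg
  · split_ifs with h
    · exact hA x
    · have h1 := (ct_neg_digits (u x) (hodd x)).1
      have h2 := (ct_neg_digits (u x) (hodd x)).2
      have h3 := hA x
      tauto
  · split_ifs with h
    · simp [h]
    · rw [(ct_neg_digits (u x) (hodd x)).1]
      simp [h]

end Summit.QuantumAdvantage.QuantumAdvantage.Theorems.NearExactIsExact.Negative.CaseATranslateFourteen

end
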